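import Mathlib
import Summits.Parity.GeneralizedHardyLittlewood.Theses.LiouvilleShiftedTables
import Literature.NumberTheory.Sieve.GoldstonPintzYildirimProposition2Holds
import Literature.NumberTheory.Sieve.GoldstonYildirimLemma21
import Literature.NumberTheory.Sieve.Polymath8aCombinatorialLemma
import Literature.Barriers.Parity.FordMaynardPrimeSieves
import Literature.NumberTheory.LFunctions.MoebiusHarmonicSumBound

/-!
# Sketch — crux `EngineToPairs` (stmt-Parity-14659), crux-ideate round 1, ideator 3

First lemmas of the three idea cards of this ideator, typed over existing declarations:

* card `gpy-anchor-sliding-truncation`: `GPYAnchor` (PROVED here from the tree's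
  `Literature.NumberTheory.Sieve.GPY.proposition2_holds`), `EHThetaErr`, `NullSumPhi`, `NullSumIdPhi`,
  and the target shape `ResidualToPairs`;
* card `generic-hb-trichotomy-engine`: `WindowTrichotomy` (the exponent lemma), `TypeI2Data`
  (the missing Ford–Maynard-style functional) and `GenericEngine`;
* card `moebius-twist-transfer`: `GYTwistLimit` (Goldston–Yıldırım Lemma 2.1, `j = 1`, in `o(1)` form).

Nothing here is an item; `lean check` rc 0 is the only claim (plus the proof of `gpyAnchor_holds`).
-/

open Finset Filter Real
open scoped Topology

namespace Summit.Parity.GeneralizedHardyLittlewood.Cruxes.EngineToPairs.Ideator3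

open Literature.NumberTheory.Sieve Literature.NumberTheory.Sieve.GPY
open Summit.Parity.GeneralizedHardyLittlewood.Theses.LiouvilleShiftedTables
  (DilatedTableChowla TypeI2Dilated ElliottHalberstam MAvg PairsHL BVLiouville)

/-- VERBATIM copy of the crux decl `…Theses.LiouvilleShiftedTables.EngineToPairs` (route file l.445;
the farm's olean of the route module predates the decl this session — same observation as
refuter-rattack-stmt-Parity-14659-0 — so the name itself cannot be referenced in a scratch check).
By `Iff.rfl` it is `DilatedTableChowla → TypeI2Dilated → ElliottHalberstam → PairsHL`. -/
def EngineToPairsV : Prop :=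
  DilatedTableChowla → TypeI2Dilated → ElliottHalberstam → ∀ h : ℕ, 1 ≤ h → (fun N : ℕ => ∑ n ∈ Finset.Icc 1 N, ArithmeticFunction.vonMangoldt n * ArithmeticFunction.vonMangoldt (n + h) - Literature.NumberTheory.Sieve.singularSeries ({0, (h : ℤ)} : Finset ℤ) * N) =o[Filter.atTop] fun N : ℕ => (N : ℝ)

example : EngineToPairsV ↔ (DilatedTableChowla → TypeI2Dilated → ElliottHalberstam → PairsHL) :=
  Iff.rfl

/-! ## Card 1 — GPY anchor + sliding truncation -/

/-- **GPY anchor.** `∑_{n ≤ N} Λ_R(n) θ(n+h) = (𝔖({0,h}) + o(1)) N` for `R ≤ N^{1/4}/(log N)^B`,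
`h ≤ R`: the case `H₁ = {0}`, `H₂ = ∅`, `ℓ₁ = ℓ₂ = 0`, `h₀ = h` of GPY Proposition 2 (tree, PROVED:
`proposition2_holds`), with `Λ_R(n) = lambdaR R {0} 0 n = ∑_{d ∣ n, d ≤ R} μ(d) log(R/d)` and the
constant ALREADY the route's `singularSeries {0, h}`. -/
def GPYAnchor : Prop :=
  ∃ B : ℝ, 0 < B ∧ ∀ δ : ℝ, 0 < δ → ∃ R₀ : ℝ, ∀ (R : ℝ) (N h : ℕ),
    R₀ ≤ R → R₀ ≤ (N : ℝ) → R ≤ (N : ℝ) ^ (1 / 4 : ℝ) / Real.log N ^ B →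
    1 ≤ h → (h : ℝ) ≤ R →
    |∑ n ∈ Icc 1 N, lambdaR R {0} 0 n * theta (n + h) -
        singularSeries ({0, (h : ℤ)} : Finset ℤ) * N| ≤ δ * N

/-- The anchor holds (specialisation of `proposition2_holds`). -/
theorem gpyAnchor_holds : GPYAnchor := by
  obtain ⟨B, hB, hP⟩ := proposition2_holds 1
  refine ⟨B, hB, fun δ hδ => ?_⟩
  obtain ⟨R₀, hR₀⟩ := hP 1 δ one_pos hδ
  refine ⟨max R₀ 1, fun R N h hR hN hRN h1 hhR => ?_⟩
  have hR₀R : R₀ ≤ R := le_trans (le_max_left _ _) hR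
  have hR1 : (1 : ℝ) ≤ R := le_trans (le_max_right _ _) hR
  have hR₀N : R₀ ≤ (N : ℝ) := le_trans (le_max_left _ _) hN
  have hRN' : R ≤ 1 * (N : ℝ) ^ (1 / 4 : ℝ) / Real.log N ^ B := by rwa [one_mul]
  have h0 : ∀ x ∈ ({0} : Finset ℕ), x ≤ h := by simp
  have he : ∀ x ∈ (∅ : Finset ℕ), x ≤ h := by simp
  have hne : ({0} : Finset ℕ).Nonempty ∨ (∅ : Finset ℕ).Nonempty := Or.inl ⟨0, by simp⟩
  have hM : #({0} : Finset ℕ) + #(∅ : Finset ℕ) + 0 + 0 = 1 := by simp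
  obtain ⟨hcase, -, -⟩ := hR₀ R N h h {0} ∅ 0 0 hR₀R hR₀N hRN' hhR h1 le_rfl h0 he hne
    (Nat.zero_le _) (Nat.zero_le _) hM
  have hnot : h ∉ ({0} : Finset ℕ) ∪ ∅ := by
    simp only [Finset.union_empty, Finset.mem_singleton]
    omega
  have key := hcase hnot
  -- simplify the GPY bookkeeping: `Λ_R(n;∅,0) = 1`, `mainTerm 0 0 0 R = 1`, `𝔖(insert h {0}) = 𝔖{0,h}`
  have hmain : mainTerm (0 + 0) 0 (#(({0} : Finset ℕ) ∩ ∅) + 0 + 0) R = 1 := by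
    simp [mainTerm]
  have hS : singularSeriesNat (insert h (({0} : Finset ℕ) ∪ ∅)) =
      singularSeries ({0, (h : ℤ)} : Finset ℤ) := by
    rw [Finset.union_empty, singularSeriesNat_def, Finset.image_insert, Finset.image_singleton,
      Nat.cast_zero, Finset.pair_comm]
  have hsum : ∑ n ∈ Icc 1 N, lambdaR R {0} 0 n * lambdaR R ∅ 0 n * theta (n + h) =
      ∑ n ∈ Icc 1 N, lambdaR R {0} 0 n * theta (n + h) := by
    refine Finset.sum_congr rfl fun n _ => ?_
    rw [lambdaR_empty_zero hR1, mul_one]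
  rw [hsum, hmain, hS, one_mul, one_mul] at key
  exact key

/-- **EH in `θ`-form at height `N`** (the only shape of the Elliott–Halberstam conjecture the line
uses; the Bombieri–Vinogradov analogue is the tree's PROVED `bombieriVinogradov_thetaErr`):
`∑_{q ≤ N^θ} E'(N, q) ≤ C N/(log N)^A` for every `θ < 1`, `A > 0`. To be derived from the crux
hypothesis `ElliottHalberstam` (`= ∀ θ < 1, PrimesHaveLevel θ`) exactly as `bombieriVinogradov_thetaErr`
is derived from `bombieri_vinogradov_holds` (ψ → θ costs `2√N log N` per modulus). -/
def EHThetaErr : Prop :=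
  ∀ θ : ℝ, θ < 1 → ∀ A : ℝ, 0 < A → ∃ C : ℝ, ∃ N₀ : ℕ, ∀ N : ℕ, N₀ ≤ N →
    ∑ q ∈ Icc 1 ⌊(N : ℝ) ^ θ⌋₊, thetaErr N q ≤ C * N / Real.log N ^ A

/-- **Null sum 1** (Goldston–Yıldırım (2.13), `j = 1`, log-power form):
`∑_{d ≤ x, (d,h)=1} μ(d)/φ(d) ≪_A (log x)^{-A}` — by the convolution transfer
`μ(d)𝟙_{(d,h)=1} d/φ(d) = ∑_{uv=d} μ(u) c_h(v)` from the tree's PROVED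
`Literature.NumberTheory.LFunctions.abs_sum_moebius_div_le_exp_neg_sqrt_log`. The VALUE of no Euler product is needed. -/
def NullSumPhi : Prop :=
  ∀ h : ℕ, 1 ≤ h → ∀ A : ℝ, 0 < A → ∃ C : ℝ, ∀ x : ℝ, 2 ≤ x →
    |∑ d ∈ (Icc 1 ⌊x⌋₊).filter (fun d => Nat.Coprime d h),
        (ArithmeticFunction.moebius d : ℝ) / (Nat.totient d : ℝ)| ≤ C / Real.log x ^ A

/-- **Null sum 2**: `∑_{d ≤ x, (d,h)=1} μ(d) d/φ(d) ≪_A x (log x)^{-A}` (same transfer, from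
`M(x) ≪ x e^{-c√log x}`, tree PROVED `abs_sum_moebius_le_mul_exp_neg_sqrt_log`). -/
def NullSumIdPhi : Prop :=
  ∀ h : ℕ, 1 ≤ h → ∀ A : ℝ, 0 < A → ∃ C : ℝ, ∀ x : ℝ, 2 ≤ x →
    |∑ d ∈ (Icc 1 ⌊x⌋₊).filter (fun d => Nat.Coprime d h),
        (ArithmeticFunction.moebius d : ℝ) * d / (Nat.totient d : ℝ)| ≤ C * x / Real.log x ^ A

/-- The quantitative parity atom the sieve half naturally delivers and the anchored Bombieri half
consumes (`T`-interface; `MAvg` is its corollary): for the shift `h` there is `ε > 0` such that for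
every `A`, `∑_{q ≤ X^ε} max_{Y ≤ X} |∑_{p ≤ Y, p ≡ h (q)} λ(p − h) log p| ≤ C X/(log X)^A`. -/
def LambdaLiouvilleAP (h : ℕ) : Prop :=
  ∃ ε : ℝ, 0 < ε ∧ ∀ A : ℝ, 0 < A → ∃ C X₀ : ℝ, ∀ X : ℕ, X₀ ≤ (X : ℝ) →
    ∀ Y : ℕ → ℕ, (∀ q, Y q ≤ X) →
      ∑ q ∈ Icc 1 ⌊(X : ℝ) ^ ε⌋₊,
        |∑ p ∈ (Icc 1 (Y q)).filter (fun p : ℕ => p.Prime ∧ p ≡ h [MOD q]),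
          (ArithmeticFunction.liouville (p - h) : ℝ) * Real.log p| ≤ C * X / Real.log X ^ A

/-- Shape of the anchored Bombieri half (card 1): EH + the `T`-atom give the route's `PairsHL`
conclusion with the constant `singularSeries {0,h}` inherited from `GPYAnchor`, never recomputed. -/
def ResidualToPairs : Prop :=
  ElliottHalberstam → (∀ h : ℕ, 1 ≤ h → LambdaLiouvilleAP h) → PairsHL

/-- Sanity: the crux is literally the composition of a sieve half with `ResidualToPairs`. -/
example (hSieve : DilatedTableChowla → TypeI2Dilated → ∀ h : ℕ, 1 ≤ h → LambdaLiouvilleAP h)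
    (hRes : ResidualToPairs) : EngineToPairsV :=
  fun hD hI hE => hRes hE (hSieve hD hI)

/-! ## Card 2 — generic Heath-Brown trichotomy engine -/

/-- **The window lemma** (exponent trichotomy for `K₀ = 3`; variant of Polymath 8a Lemma 3.1, which is
PROVED in the tree as `Polymath8a.combinatorialLemma`). Exponents `t i ≥ 0` of the `2j ≤ 6` factors of a
Heath-Brown piece sum to `1`; the Möbius factors (`i ∈ mu`) have `t i ≤ 1/3`. Then either some
sub-product lies in the Type-II window `[δ₁, 1/3+δ₁] ∪ [2/3−δ₁, 1−δ₁]`, or one smooth factor has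
exponent `≥ 1/2 + 2δ₁` (Type I at level `≤ 1/2 − 2δ₁`), or two smooth factors lie in
`(1/2 − 3δ₁, 1/2 + 2δ₁)` and everything else has total exponent `< δ₁` (Type I₂). -/
def WindowTrichotomy : Prop :=
  ∀ (ι : Type) [Fintype ι] [DecidableEq ι] (mu : Finset ι) (t : ι → ℝ) (δ₁ : ℝ),
    0 < δ₁ → δ₁ ≤ 1 / 6 → (∀ i, 0 ≤ t i) → (∀ i ∈ mu, t i ≤ 1 / 3) → ∑ i, t i = 1 →
    (∃ S : Finset ι, (δ₁ ≤ ∑ i ∈ S, t i ∧ ∑ i ∈ S, t i ≤ 1 / 3 + δ₁) ∨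
        (2 / 3 - δ₁ ≤ ∑ i ∈ S, t i ∧ ∑ i ∈ S, t i ≤ 1 - δ₁)) ∨
    (∃ i, i ∉ mu ∧ 1 / 2 + 2 * δ₁ ≤ t i) ∨
    (∃ i j, i ∉ mu ∧ j ∉ mu ∧ i ≠ j ∧
        1 / 2 - 3 * δ₁ < t i ∧ t i < 1 / 2 + 2 * δ₁ ∧
        1 / 2 - 3 * δ₁ < t j ∧ t j < 1 / 2 + 2 * δ₁ ∧
        ∑ k ∈ (Finset.univ.erase i).erase j, t k < δ₁)

/-- **Type-I₂ information** for a real weight `w` at height `x` (the functional Ford–Maynard's set-up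
lacks; shape = the crux `TypeI2Dilated` for one dilation, with divisor weights on `r` so that the engine
is linear in the datum): for all `1 ≤ R ≤ x^ρ`, `S ≥ 0` with `SR ≤ x^{1/2+ρ}` and `0 ≤ y ≤ x`,
`∑_{r ≤ R} τ(r)^B |∑_{s ≤ S} ∑_{n ≤ y/(sr)} w(rsn)| ≤ E`. -/
def TypeI2Data (w : ℕ → ℝ) (x ρ B E : ℝ) : Prop :=
  ∀ R S y : ℝ, 1 ≤ R → R ≤ x ^ ρ → 0 ≤ S → S * R ≤ x ^ (1 / 2 + ρ) → 0 ≤ y → y ≤ x →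
    ∑ r ∈ Icc 1 ⌊R⌋₊, ((r.divisors.card : ℝ) ^ B) *
      |∑ s ∈ Icc 1 ⌊S⌋₊, ∑ n ∈ Icc 1 ⌊y / (s * r)⌋₊, w (r * s * n)| ≤ E

/-- Ford–Maynard's Type-I functional with a free threshold `E` (their `TypeI w x γ B` is `E = x/(log x)^B`). -/
def TypeIData (w : ℕ → ℝ) (x γ B E : ℝ) : Prop :=
  ∀ I : ℕ → ℕ × ℕ,
    ∑ m ∈ Icc 1 ⌊x ^ γ⌋₊, ((m.divisors.card : ℝ) ^ B) *
        |∑ n ∈ (Icc (I m).1 (I m).2).filter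
            (fun n : ℕ => x / 2 < (m * n : ℝ) ∧ (m * n : ℝ) ≤ x), w (m * n)| ≤ E

/-- Ford–Maynard's Type-II functional with a free threshold `E`. -/
def TypeIIData (w : ℕ → ℝ) (x θ ν B E : ℝ) : Prop :=
  ∀ ξ κ : ℕ → ℂ, (∀ m, ‖ξ m‖ ≤ (m.divisors.card : ℝ) ^ B) →
    (∀ n, ‖κ n‖ ≤ (n.divisors.card : ℝ) ^ B) →
      ‖∑ m ∈ (Icc 1 ⌊x ^ (θ + ν)⌋₊).filter (fun m : ℕ => (x / 2) ^ θ < (m : ℝ)),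
          ∑ n ∈ (Icc 1 ⌊x⌋₊).filter (fun n : ℕ => x / 2 < (m * n : ℝ) ∧ (m * n : ℝ) ≤ x),
            ξ m * κ n * (w (m * n) : ℂ)‖ ≤ E

/-- With `E = x/(log x)^B` these are Ford–Maynard's own `TypeI`/`TypeII` (by `rfl`). -/
example (w : ℕ → ℝ) (x γ B : ℝ) :
    TypeIData w x γ B (x / Real.log x ^ B) ↔ Literature.Barriers.Parity.FordMaynard.TypeI w x γ B :=
  Iff.rfl

example (w : ℕ → ℝ) (x θ ν B : ℝ) :
    TypeIIData w x θ ν B (x / Real.log x ^ B) ↔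
      Literature.Barriers.Parity.FordMaynard.TypeII w x θ ν B :=
  Iff.rfl

/-- **Generic Heath-Brown trichotomy engine** (weight-agnostic; the sieve half of the crux is its
instantiation at `w_q(n) = λ(n − h)𝟙_{n ≡ h (q)}` summed over `q ≤ X^{2ε}`): for `0 < δ₁ ≤ 1/16` and
every `A` there are `B, C, x₀` such that for `x ≥ x₀`, every weight `|w| ≤ 1` and all thresholds
`E_I, E_II, E_I2 ≥ 0`, Type-I data at level `1/2 − δ₁`, Type-II data on `[δ₁, 1/3 + δ₁]` and Type-I₂
data at `ρ = 4δ₁` give `|∑_{x/2 < n ≤ x} Λ(n) w(n)| ≤ C (log x)^B (E_I + E_II + E_I2) + C x^{1 − δ₁/20}`. -/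
def GenericEngine : Prop :=
  ∀ δ₁ : ℝ, 0 < δ₁ → δ₁ ≤ 1 / 16 → ∀ A : ℝ, 0 < A → ∃ B C x₀ : ℝ, ∀ x : ℝ, x₀ ≤ x →
    ∀ w : ℕ → ℝ, (∀ n, |w n| ≤ 1) → ∀ EI EII EI2 : ℝ, 0 ≤ EI → 0 ≤ EII → 0 ≤ EI2 →
      TypeIData w x (1 / 2 - δ₁) B EI → TypeIIData w x δ₁ (1 / 3) B EII →
      TypeI2Data w x (4 * δ₁) B EI2 →
        |∑ n ∈ (Icc 1 ⌊x⌋₊).filter (fun n : ℕ => x / 2 < (n : ℝ)),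
            ArithmeticFunction.vonMangoldt n * w n| ≤
          C * Real.log x ^ B * (EI + EII + EI2) + C * x ^ (1 - δ₁ / 20)

/-! ## Card 3 — Möbius twist transfer (Goldston–Yıldırım Lemma 2.1 at `j = 1`, `o(1)` form) -/

/-- `∑_{d ≤ R, (d,h)=1} μ(d) log(R/d)/φ(d) → 𝔖({0,h})` (`R → ∞`, `h ≥ 1` fixed): Bombieri's level-1
main term, = the weak form of the tree's named fact `goldstonYildirim_lemma21_log_j1` that the route's
`PairsFromMAvg` needs; to be proved by the convolution transfer from the tree's PROVED untwisted sums. -/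
def GYTwistLimit : Prop :=
  ∀ h : ℕ, 1 ≤ h →
    Tendsto (fun R : ℝ => ∑ d ∈ (Icc 1 ⌊R⌋₊).filter (fun d => Nat.Coprime d h),
        ((ArithmeticFunction.moebius d : ℤ) : ℝ) / (Nat.totient d : ℝ) * Real.log (R / d))
      atTop (𝓝 (singularSeries ({0, (h : ℤ)} : Finset ℤ)))

/-- The named fact (uniform, with rate) implies the weak form used here. -/
theorem gyTwistLimit_of_lemma21 (hGY : goldstonYildirim_lemma21_log_j1) : GYTwistLimit := by
  intro h hh
  obtain ⟨c, hc, hB⟩ := hGY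
  obtain ⟨C, hC⟩ := hB 1 one_pos
  rw [Metric.tendsto_atTop]
  intro ε hε
  -- `C e^{-c√log R} < ε` and `h ≤ R` for large `R`
  have hlim : Tendsto (fun R : ℝ => C * Real.exp (-c * Real.sqrt (Real.log R))) atTop (𝓝 (C * 0)) := by
    refine Tendsto.const_mul C (Real.tendsto_exp_atBot.comp ?_)
    exact (Real.tendsto_sqrt_atTop.comp Real.tendsto_log_atTop).const_mul_atTop_of_neg
      (by linarith : -c < 0)
  rw [mul_zero] at hlim
  obtain ⟨R₁, hR₁⟩ := (Metric.tendsto_atTop.1 hlim) ε hε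
  refine ⟨max (max R₁ 1) h, fun R hR => ?_⟩
  have hRR₁ : R₁ ≤ R := le_trans (le_trans (le_max_left _ _) (le_max_left _ _)) hR
  have hR1 : (1 : ℝ) ≤ R := le_trans (le_trans (le_max_right _ _) (le_max_left _ _)) hR
  have hhR : (h : ℝ) ≤ R ^ (1 : ℝ) := by rw [Real.rpow_one]; exact le_trans (le_max_right _ _) hR
  have key := hC h hh R hR1 hhR
  have hb := hR₁ R hRR₁
  rw [Real.dist_eq, sub_zero] at hb
  rw [Real.dist_eq]
  calc |(∑ d ∈ (Icc 1 ⌊R⌋₊).filter (fun d => Nat.Coprime d h),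
          ((ArithmeticFunction.moebius d : ℤ) : ℝ) / (Nat.totient d : ℝ) * Real.log (R / d)) -
          singularSeries ({0, (h : ℤ)} : Finset ℤ)|
      ≤ C * Real.exp (-c * Real.sqrt (Real.log R)) := key
    _ ≤ |C * Real.exp (-c * Real.sqrt (Real.log R))| := le_abs_self _
    _ < ε := hb

end Summit.Parity.GeneralizedHardyLittlewood.Cruxes.EngineToPairs.Ideator3
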